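import Summits.QuantumFields.BalabanUV.Beta.WilsonFluctuationWard22
import Summits.QuantumFields.BalabanUV.Beta.WilsonFluctuationWard22Letters

/-!
# `BalabanUV.Beta.WilsonFluctuationWard22Entry` — the fluctuation-gauge Ward identity (E₂) AT BOND LETTERS, ENTRYWISE WITH COLOUR, on every finite
# lattice (file (R2b) of the kernel route to the fluctuation-LEG pure-gauge law of the Wilson bi-stencil `wilsonW₂ d ((8N²)⁻¹ • wsym22 N)` and to the
# torus row `torus_a2_wilson`; D1 formalisation swarm seat `b2b-balaban-beta-d1-formalise-leaf-05`, gen 35)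

HONEST FRAMING (cell charter, verbatim): «discharging `BetaPertH` makes Bałaban's UV stability UNCONDITIONAL — a real
constructive-QFT result; it is NOT the continuum limit and NOT the Clay problem.»  HONEST DEPENDENCY (cell records, verbatim):
«continuum YM on T⁴ ⇐ BetaPertH ∧ nine spine estimates (0/9 proved); BetaPertH ⇐ (D1) ∧ (D4) ∧ CAP+tail; G-an2-4 gates asym, D1 and
NE2/3/4.»  DERIVED cell leaf: [folklore] finite-dimensional algebra over an arbitrary finite abelian lattice, no estimate, no limit, nothing
cited — every statement is kernel-proved here; no `[cite:]` tag, no `def`, no `def … : Prop`.  By itself this file instantiates NO binder of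
the β-function wall and NO row of the door.  NOT D1, NOT `BetaPertH`, NOT continuum, NOT Clay.  «not in print; our bookkeeping».
ABSOLUTE RULE (cell charter, verbatim): «No internally-minted statement may enter as a cited fact. Every hypothesis is either
kernel-proved in this package or a verbatim quotation of a PUBLISHED theorem with page reference. The manuscript(s) under audit are
NOT citable for their own disputed steps — they are the thing under adjudication; programme-internal (2001/route/tribunal) claims are
never citable.»

## What

(R1) `WilsonFluctuationWard22.jet22_flucWard` (an3's (E₂) summed over a finite lattice) is read here at ONE-BOND LETTER FIELDS: the fluctuation
test leg `h = bondLetter x α X`, the gauge parameter `λ = ℓ • X` WITH THE SAME LETTER (so the `N₀`-current `[h, λ₋ + λ₊]` vanishes identically,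
`WilsonFluctuationWard22Letters.currArg₀_bondLetter_smul_self`), and the background POLARISED between two bond letters
`B₁ = bondLetter u κ Y₁`, `B₂ = bondLetter u′ κ′ Y₂` (`Φ(B₁ + B₂) − Φ(B₁) − Φ(B₂)` of the `B`-quadratic identity).  Each of the four surviving jet
groups is evaluated by the letter lemmas of (R2a):
* the `(2,2)` group through an3's two-bond vertices `wilsonVertex₂ τ ![X, Y₁, Y₂]` at the background points `(u,(1,κ))`, `(u′,(2,κ′))`, both fluctuation
  colours `0` (the letter `X`), weighted by the profile differences `ℓ z − ℓ(z + e_γ)` of the pure-gauge leg — LEFT UNEVALUATED (the sequel traces them);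
* the `(2,1)` group = `−4·2·(τ(Y₂·[X,K₁])·S₀A e u′ κ′ (x,α) (u,κ) + τ(Y₁·[X,K₂])·S₀A e u κ (x,α) (u′,κ′))`, `K_i = ℓ(tip b_i) • (X·Y_i − Y_i·X)` — an3's
  antisymmetrised colourless stencil with its second leg AT THE OTHER BACKGROUND BOND, weighted at that bond's TIP;
* the `(2,0)` group (the doubled second gauge direction, cross part) = `2·(2·Lc e κ u (x,α))·τ(X·[b₁ = b₂]·(Y₁K₂ − K₂Y₁ + Y₂K₁ − K₁Y₂))` — a SAME-BOND
  contact against leaf-05-g2's curl–curl coefficient `Lc`;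
* the `(1,1)` current (cross part) = `2·((2·Lc e κ′ u′ (x,α))·τ([p = b₁]·(K₁X − XK₁)·Y₂) + (2·Lc e κ u (x,α))·τ([p = b₂]·(K₂X − XK₂)·Y₁))` — a
  BOND-EQUALS-LEG contact.
Main theorem **`flucWard22_letters`**; all letters `X Y₁ Y₂`, profile `ℓ`, bonds free.  NOT HERE ((R2c), (R3), (R4)): the fluctuation-colour trace
(`X := gen τ a`, `Y₁ = Y₂ := gen τ c`, `Σ_a`: an3's `sum_cwordV_diag` ∕ lit1's seagull weights), the transfer to `ℤ^{d+1}` and the torus row.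
Provenance: pub-balaban β sub-cell, D1 formalisation swarm, unit `b2b-balaban-beta-d1-formalise-leaf-05` gen 35, 2026-08-23 (v1); over (R1), (R2a) and
an3's ∕ leaf-09's ∕ leaf-05-g2's files named there BY NAME; no existing file touched.
-/

namespace Summit.QuantumFields.BalabanUV.Beta.WilsonFluctuationWard22Entry

open Finset
open scoped BigOperators Matrix
open Literature.MathematicalPhysics.QuantumFieldTheory.Balaban1983to89.Beta
open Literature.MathematicalPhysics.QuantumFieldTheory.Balaban1983to89.Beta.SpinTable (br)
open Literature.MathematicalPhysics.QuantumFieldTheory.Balaban1983to89.Beta.PlaquetteVertex (field bondLetter lcurl lcurl_add lcurl_sub jet21 jet20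
  plaqWord)
open Literature.MathematicalPhysics.QuantumFieldTheory.Balaban1983to89.Beta.PlaquetteVertex2 (jet22)
open Literature.MathematicalPhysics.QuantumFieldTheory.Balaban1983to89.Beta.PlaquetteBackground (jet21_add_bg)
open Literature.MathematicalPhysics.QuantumFieldTheory.Balaban1983to89.Beta.WilsonWardJets (gaugeDir₀ gaugeDir₁ currArg₀ jet11)
open Literature.MathematicalPhysics.QuantumFieldTheory.Balaban1983to89.Beta.WilsonWardJets2 (jet12)
open Literature.MathematicalPhysics.QuantumFieldTheory.Balaban1983to89.Beta.WilsonWard22 (polar_add P21_plaq_polar₃)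
open Literature.MathematicalPhysics.QuantumFieldTheory.Balaban1983to89.Beta.WilsonVertex2Kron (wilsonVertex₂)
open Summit.QuantumFields.BalabanUV.Beta.WilsonReflectionFrame (Lc S₀A)
open Summit.QuantumFields.BalabanUV.Beta.WilsonJetReflection2Polar (jet20_polar)
open Summit.QuantumFields.BalabanUV.Beta.WilsonBiStencilWardFrame (field_add)
open Summit.QuantumFields.BalabanUV.Beta.WilsonFluctuationWard22 (jet22_flucWard)
open Summit.QuantumFields.BalabanUV.Beta.WilsonFluctuationWard22Letters

/-! ## §1 Bookkeeping: deltas, additivity of the chart's letter fields, the cross fields -/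

section Bookkeeping

variable {Λ : Type*} [Fintype Λ] [DecidableEq Λ] {C : Type*} [Fintype C] [DecidableEq C] {D : Type*} [Fintype D] [DecidableEq D]

/-- [folklore] a double delta sum collapses: `Σ_{p₁} Σ_{p₂} (δ_{P₁} p₁ · δ_{P₂} p₂) • M p₁ p₂ = M P₁ P₂`. -/
theorem sum_single_mul_single_smul {β : Type*} [AddCommMonoid β] [Module ℝ β] (P₁ P₂ : Λ × (C × D)) (M : Λ × (C × D) → Λ × (C × D) → β) :
    ∑ p₁, ∑ p₂, ((Pi.single P₁ (1 : ℝ) : Λ × (C × D) → ℝ) p₁ * (Pi.single P₂ (1 : ℝ) : Λ × (C × D) → ℝ) p₂) • M p₁ p₂ = M P₁ P₂ := by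
  rw [Finset.sum_eq_single P₁]
  · rw [Finset.sum_eq_single P₂]
    · simp
    · intro p₂ _ hp; rw [Pi.single_eq_of_ne hp, mul_zero, zero_smul]
    · intro h; exact absurd (Finset.mem_univ _) h
  · intro p₁ _ hp
    exact Finset.sum_eq_zero fun p₂ _ => by rw [Pi.single_eq_of_ne hp, zero_mul, zero_smul]
  · intro h; exact absurd (Finset.mem_univ _) h

end Bookkeeping

section Fields

variable {𝔸 : Type*} [NormedRing 𝔸] [NormedAlgebra ℝ 𝔸]
variable {Λ : Type*} [DecidableEq Λ] [AddCommGroup Λ] {D : Type*} [DecidableEq D]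

omit [NormedAlgebra ℝ 𝔸] [DecidableEq Λ] [DecidableEq D] in
/-- [folklore] the order-`B¹` gauge direction is additive in the background. -/
theorem gaugeDir₁_add (e : D → Λ) (B B' : Λ → D → 𝔸) (lam : Λ → 𝔸) :
    gaugeDir₁ e (B + B') lam = gaugeDir₁ e B lam + gaugeDir₁ e B' lam := by
  funext x μ
  simp only [gaugeDir₁, Pi.add_apply]
  noncomm_ring

omit [NormedAlgebra ℝ 𝔸] [AddCommGroup Λ] in
/-- [folklore] a conditional letter on the bond `(u′,κ′)`, conditioned on `(u′,κ′) = (u,κ)`, is the same conditional letter on `(u,κ)`. -/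
theorem bondLetter_ite_swap (u : Λ) (κ : D) (u' : Λ) (κ' : D) (Z : 𝔸) :
    bondLetter u' κ' (if u' = u ∧ κ' = κ then Z else 0) = bondLetter u κ (if u = u' ∧ κ = κ' then Z else 0) := by
  by_cases h : u' = u ∧ κ' = κ
  · obtain ⟨rfl, rfl⟩ := h
    simp
  · have h' : ¬(u = u' ∧ κ = κ') := fun hc => h ⟨hc.1.symm, hc.2.symm⟩
    rw [if_neg h, if_neg h']
    funext y δ
    simp [bondLetter]

omit [NormedAlgebra ℝ 𝔸] [AddCommGroup Λ] in
/-- [folklore] bond letters are additive in the letter. -/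
theorem bondLetter_add (z : Λ) (γ : D) (A A' : 𝔸) : bondLetter z γ (A + A') = bondLetter z γ A + bondLetter z γ A' := by
  funext y δ; simp only [bondLetter, Pi.add_apply]; split_ifs <;> simp

omit [NormedAlgebra ℝ 𝔸] [AddCommGroup Λ] in
/-- [folklore] bond letters are subtractive in the letter. -/
theorem bondLetter_sub (z : Λ) (γ : D) (A A' : 𝔸) : bondLetter z γ (A - A') = bondLetter z γ A - bondLetter z γ A' := by
  funext y δ; simp only [bondLetter, Pi.sub_apply]; split_ifs <;> simp

omit [NormedAlgebra ℝ 𝔸] [DecidableEq Λ] [AddCommGroup Λ] [DecidableEq D] in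
/-- [folklore] conditional letters combine. -/
theorem ite_letter_comb (P : Prop) [Decidable P] (A B C E : 𝔸) :
    (if P then A else 0) - (if P then B else 0) + ((if P then C else 0) - (if P then E else 0)) = if P then A - B + (C - E) else 0 := by
  split_ifs <;> simp

/-- [folklore] **THE CROSS PART OF THE DOUBLED SECOND GAUGE DIRECTION `2W₂(B)λ = B·(W₁(B)λ) − (W₁(B)λ)·B` between two bond letters** lives on a
common bond: with `K₁ = ℓ(u + e_κ) • (XY₁ − Y₁X)`, `K₂ = ℓ(u′ + e_κ′) • (XY₂ − Y₂X)`,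
`2W₂(B₁ + B₂) − 2W₂(B₁) − 2W₂(B₂) = bondLetter u κ ([b₁ = b₂]·(Y₁K₂ − K₂Y₁ + (Y₂K₁ − K₁Y₂)))`. -/
theorem gaugeDir₂_cross (e : D → Λ) (u : Λ) (κ : D) (u' : Λ) (κ' : D) (Y₁ Y₂ X : 𝔸) (ell : Λ → ℝ) :
    (fun y k => (bondLetter u κ Y₁ + bondLetter u' κ' Y₂) y k * gaugeDir₁ e (bondLetter u κ Y₁ + bondLetter u' κ' Y₂) (fun y => ell y • X) y k
        - gaugeDir₁ e (bondLetter u κ Y₁ + bondLetter u' κ' Y₂) (fun y => ell y • X) y k * (bondLetter u κ Y₁ + bondLetter u' κ' Y₂) y k)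
      - (fun y k => bondLetter u κ Y₁ y k * gaugeDir₁ e (bondLetter u κ Y₁) (fun y => ell y • X) y k
          - gaugeDir₁ e (bondLetter u κ Y₁) (fun y => ell y • X) y k * bondLetter u κ Y₁ y k)
      - (fun y k => bondLetter u' κ' Y₂ y k * gaugeDir₁ e (bondLetter u' κ' Y₂) (fun y => ell y • X) y k
          - gaugeDir₁ e (bondLetter u' κ' Y₂) (fun y => ell y • X) y k * bondLetter u' κ' Y₂ y k) =
      bondLetter u κ (if u = u' ∧ κ = κ' then
        Y₁ * (ell (u' + e κ') • (X * Y₂ - Y₂ * X)) - (ell (u' + e κ') • (X * Y₂ - Y₂ * X)) * Y₁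
          + (Y₂ * (ell (u + e κ) • (X * Y₁ - Y₁ * X)) - (ell (u + e κ) • (X * Y₁ - Y₁ * X)) * Y₂) else 0) := by
  rw [gaugeDir₁_add, gaugeDir₁_bondLetter_smul, gaugeDir₁_bondLetter_smul]
  set K₁ := ell (u + e κ) • (X * Y₁ - Y₁ * X)
  set K₂ := ell (u' + e κ') • (X * Y₂ - Y₂ * X)
  funext y k
  simp only [Pi.sub_apply, Pi.add_apply, bondLetter]
  by_cases h1 : y = u ∧ k = κ
  · obtain ⟨rfl, rfl⟩ := h1
    by_cases h2 : y = u' ∧ k = κ'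
    · obtain ⟨rfl, rfl⟩ := h2
      simp only [and_self, if_true]
      noncomm_ring
    · simp only [and_self, if_true, if_neg h2]
      noncomm_ring
  · simp only [if_neg h1]
    by_cases h2 : y = u' ∧ k = κ'
    · obtain ⟨rfl, rfl⟩ := h2
      simp only [and_self, if_true]
      noncomm_ring
    · simp only [if_neg h2]
      noncomm_ring

/-- [folklore] **THE CURRENT ARGUMENT `N₁ = [W₁(B)λ, h]` OF A BOND-LETTER FLUCTUATION AT A BOND-LETTER BACKGROUND** lives on the fluctuation's bond:
`W₁(bondLetter u κ Y)λ · h − h · W₁(…)λ = bondLetter x α ([(x,α) = (u,κ)]·(K·X − X·K))`, `K = ℓ(u + e_κ) • (X·Y − Y·X)`. -/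
theorem currArg₁_bondLetters (e : D → Λ) (u : Λ) (κ : D) (Y X : 𝔸) (ell : Λ → ℝ) (x : Λ) (α : D) :
    (fun y k => gaugeDir₁ e (bondLetter u κ Y) (fun y => ell y • X) y k * bondLetter x α X y k
        - bondLetter x α X y k * gaugeDir₁ e (bondLetter u κ Y) (fun y => ell y • X) y k) =
      bondLetter x α (if x = u ∧ α = κ then
        (ell (u + e κ) • (X * Y - Y * X)) * X - X * (ell (u + e κ) • (X * Y - Y * X)) else 0) := by
  rw [gaugeDir₁_bondLetter_smul]
  set K := ell (u + e κ) • (X * Y - Y * X)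
  funext y k
  simp only [bondLetter]
  by_cases h1 : y = x ∧ k = α
  · obtain ⟨rfl, rfl⟩ := h1
    by_cases h2 : y = u ∧ k = κ
    · obtain ⟨rfl, rfl⟩ := h2
      simp only [and_self, if_true]
    · simp only [and_self, if_true, if_neg h2]
      noncomm_ring
  · simp only [if_neg h1]
    noncomm_ring

variable [Fintype Λ] [Fintype D]

omit [DecidableEq Λ] [DecidableEq D] in
/-- [folklore] **THE `W`-POLAR FORM OF THE `(2,1)`-JET IS ADDITIVE IN ITS SECOND ARGUMENT** (an3's `P21_plaq_polar₃`: `P21 ∘ plaq` is W-quadratic;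
`WilsonWard22.polar_add`). -/
theorem jet21_polarW_add_right (τ : 𝔸 →ₗ[ℝ] ℝ) (e : D → Λ) (h k k' B : Λ → D → 𝔸) :
    jet21 ℝ τ e (h + (k + k')) B - jet21 ℝ τ e h B - jet21 ℝ τ e (k + k') B =
      (jet21 ℝ τ e (h + k) B - jet21 ℝ τ e h B - jet21 ℝ τ e k B) + (jet21 ℝ τ e (h + k') B - jet21 ℝ τ e h B - jet21 ℝ τ e k' B) := by
  refine polar_add (fun W => jet21 ℝ τ e W B) (fun a b c => ?_) h k k'
  simp only [jet21, ← Finset.sum_sub_distrib, ← Finset.sum_add_distrib]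
  refine Finset.sum_eq_zero fun x _ => Finset.sum_eq_zero fun μ _ => Finset.sum_eq_zero fun ν _ => ?_
  simp only [plaqWord, Pi.add_apply]
  rw [← map_sub, ← map_sub, ← map_sub, ← map_add, ← map_add, ← map_add, P21_plaq_polar₃, map_zero]

omit [DecidableEq Λ] [DecidableEq D] in
/-- [folklore] the kinetic pairing is additive on the right (any fields). -/
theorem kin_add_right (τ : 𝔸 →ₗ[ℝ] ℝ) (e : D → Λ) (A E E' : Λ → D → 𝔸) :
    ∑ x, ∑ μ, ∑ ν, τ (lcurl e A x μ ν * lcurl e (E + E') x μ ν) =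
      (∑ x, ∑ μ, ∑ ν, τ (lcurl e A x μ ν * lcurl e E x μ ν)) + ∑ x, ∑ μ, ∑ ν, τ (lcurl e A x μ ν * lcurl e E' x μ ν) := by
  simp only [lcurl_add, mul_add, map_add, Finset.sum_add_distrib]

omit [DecidableEq Λ] [DecidableEq D] in
/-- [folklore] the kinetic pairing is subtractive on the right (any fields). -/
theorem kin_sub_right (τ : 𝔸 →ₗ[ℝ] ℝ) (e : D → Λ) (A E E' : Λ → D → 𝔸) :
    ∑ x, ∑ μ, ∑ ν, τ (lcurl e A x μ ν * lcurl e (E - E') x μ ν) =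
      (∑ x, ∑ μ, ∑ ν, τ (lcurl e A x μ ν * lcurl e E x μ ν)) - ∑ x, ∑ μ, ∑ ν, τ (lcurl e A x μ ν * lcurl e E' x μ ν) := by
  simp only [lcurl_sub, mul_sub, map_sub, Finset.sum_sub_distrib]

end Fields

/-! ## §2 The identity at bond letters -/

section Main

variable {𝔸 : Type*} [NormedRing 𝔸] [NormedAlgebra ℝ 𝔸]
variable {Λ : Type*} [Fintype Λ] [DecidableEq Λ] [AddCommGroup Λ] {D : Type*} [Fintype D] [DecidableEq D]

omit [DecidableEq Λ] [DecidableEq D] in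
/-- [folklore] a matrix applied to the colour-`0` profile-difference vector, read at a point: the sum over the gauge leg `(z, γ)`. -/
theorem mulVec_gaugeVec_apply (e : D → Λ) (ell : Λ → ℝ) (M : Matrix (Λ × (Fin 3 × D)) (Λ × (Fin 3 × D)) ℝ) (P : Λ × (Fin 3 × D)) :
    (M *ᵥ fun Q : Λ × (Fin 3 × D) => if Q.2.1 = 0 then ell Q.1 - ell (Q.1 + e Q.2.2) else 0) P =
      ∑ z, ∑ γ, M P (z, ((0 : Fin 3), γ)) * (ell z - ell (z + e γ)) := by
  simp only [Matrix.mulVec, dotProduct, Fintype.sum_prod_type, mul_ite, mul_zero]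
  refine Finset.sum_congr rfl fun z _ => ?_
  rw [Fin.sum_univ_three]
  simp

omit [NormedAlgebra ℝ 𝔸] [Fintype Λ] [DecidableEq Λ] [Fintype D] [DecidableEq D] in
/-- [folklore] the current argument `N₁(B) = W₁(B)λ·h − h·W₁(B)λ` is additive in the background. -/
theorem currArg₁_add (e : D → Λ) (h B B' : Λ → D → 𝔸) (lam : Λ → 𝔸) :
    (fun y k => gaugeDir₁ e (B + B') lam y k * h y k - h y k * gaugeDir₁ e (B + B') lam y k) =
      (fun y k => gaugeDir₁ e B lam y k * h y k - h y k * gaugeDir₁ e B lam y k)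
        + fun y k => gaugeDir₁ e B' lam y k * h y k - h y k * gaugeDir₁ e B' lam y k := by
  funext y k
  simp only [gaugeDir₁_add, Pi.add_apply]
  noncomm_ring

/-- [folklore] **THE FLUCTUATION-GAUGE WARD IDENTITY (E₂) AT BOND LETTERS, ENTRYWISE WITH COLOUR** (see the module docstring).  For every finite
lattice `Λ` with frame `e`, normed real algebra `𝔸` with tracial `τ`, letters `X` (fluctuation test leg AND gauge parameter), `Y₁`, `Y₂` (the two
background bond letters), site profile `ℓ`, test leg `(x, α)` and background bonds `(u, κ)`, `(u′, κ′)`: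
`4·Σ_{z,γ} (X₁₂ + X₁₂ᵀ)((x,0,α),(z,0,γ))·(ℓ z − ℓ(z+e_γ)) − 4·2·(τ(Y₂·[X,K₁])·S₀A e u′ κ′ (x,α) (u,κ) + τ(Y₁·[X,K₂])·S₀A e u κ (x,α) (u′,κ′))`
`+ 2·(2·Lc e κ u (x,α))·τ(X·[b₁ = b₂](Y₁K₂ − K₂Y₁ + Y₂K₁ − K₁Y₂)) = 2·((2·Lc e κ′ u′ (x,α))·τ([p = b₁](K₁X − XK₁)·Y₂) + (2·Lc e κ u (x,α))·τ([p = b₂](K₂X − XK₂)·Y₁))`,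
`X₁₂ = wilsonVertex₂ τ ![X,Y₁,Y₂] e (u,(1,κ)) (u′,(2,κ′)) + wilsonVertex₂ τ ![X,Y₁,Y₂] e (u′,(2,κ′)) (u,(1,κ))`, `K₁ = ℓ(u+e_κ) • (XY₁ − Y₁X)`,
`K₂ = ℓ(u′+e_κ′) • (XY₂ − Y₂X)`. -/
theorem flucWard22_letters (τ : 𝔸 →ₗ[ℝ] ℝ) (hτ : ∀ a b : 𝔸, τ (a * b) = τ (b * a)) (e : D → Λ) (X Y₁ Y₂ : 𝔸) (ell : Λ → ℝ)
    (x : Λ) (α : D) (u : Λ) (κ : D) (u' : Λ) (κ' : D) :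
    4 * (∑ z : Λ, ∑ γ : D,
        ((wilsonVertex₂ τ ![X, Y₁, Y₂] e (u, ((1 : Fin 3), κ)) (u', ((2 : Fin 3), κ'))
              + wilsonVertex₂ τ ![X, Y₁, Y₂] e (u', ((2 : Fin 3), κ')) (u, ((1 : Fin 3), κ))) (x, ((0 : Fin 3), α)) (z, ((0 : Fin 3), γ))
          + (wilsonVertex₂ τ ![X, Y₁, Y₂] e (u, ((1 : Fin 3), κ)) (u', ((2 : Fin 3), κ'))
              + wilsonVertex₂ τ ![X, Y₁, Y₂] e (u', ((2 : Fin 3), κ')) (u, ((1 : Fin 3), κ))) (z, ((0 : Fin 3), γ)) (x, ((0 : Fin 3), α)))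
          * (ell z - ell (z + e γ)))
      - 4 * (2 * τ (Y₂ * (X * (ell (u + e κ) • (X * Y₁ - Y₁ * X)) - (ell (u + e κ) • (X * Y₁ - Y₁ * X)) * X)) * S₀A e u' κ' (x, α) (u, κ)
          + 2 * τ (Y₁ * (X * (ell (u' + e κ') • (X * Y₂ - Y₂ * X)) - (ell (u' + e κ') • (X * Y₂ - Y₂ * X)) * X)) * S₀A e u κ (x, α) (u', κ'))
      + 2 * ((2 * Lc e κ u (x, α)) * τ (X * (if u = u' ∧ κ = κ' then
          Y₁ * (ell (u' + e κ') • (X * Y₂ - Y₂ * X)) - (ell (u' + e κ') • (X * Y₂ - Y₂ * X)) * Y₁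
            + (Y₂ * (ell (u + e κ) • (X * Y₁ - Y₁ * X)) - (ell (u + e κ) • (X * Y₁ - Y₁ * X)) * Y₂) else 0))) =
      2 * ((2 * Lc e κ' u' (x, α)) * τ ((if x = u ∧ α = κ then
              (ell (u + e κ) • (X * Y₁ - Y₁ * X)) * X - X * (ell (u + e κ) • (X * Y₁ - Y₁ * X)) else 0) * Y₂)
          + (2 * Lc e κ u (x, α)) * τ ((if x = u' ∧ α = κ' then
              (ell (u' + e κ') • (X * Y₂ - Y₂ * X)) * X - X * (ell (u' + e κ') • (X * Y₂ - Y₂ * X)) else 0) * Y₁)) := by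
  -- letters and fields
  set T : Fin 3 → 𝔸 := ![X, Y₁, Y₂] with hT
  set K₁ : 𝔸 := ell (u + e κ) • (X * Y₁ - Y₁ * X) with hK₁
  set K₂ : 𝔸 := ell (u' + e κ') • (X * Y₂ - Y₂ * X) with hK₂
  set lam : Λ → 𝔸 := fun y => ell y • X with hlam
  set h : Λ → D → 𝔸 := bondLetter x α X with hh
  set B₁ : Λ → D → 𝔸 := bondLetter u κ Y₁ with hB₁
  set B₂ : Λ → D → 𝔸 := bondLetter u' κ' Y₂ with hB₂
  have hT0 : T 0 = X := rfl
  have hT1 : T 1 = Y₁ := rfl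
  have hT2 : T 2 = Y₂ := rfl
  -- (R1) at the three backgrounds, the `N₀`-current gone
  have hN0 : currArg₀ e h lam = 0 := currArg₀_bondLetter_smul_self e x α X ell
  have R12 := jet22_flucWard ℝ τ hτ e h (B₁ + B₂) lam
  have R1 := jet22_flucWard ℝ τ hτ e h B₁ lam
  have R2 := jet22_flucWard ℝ τ hτ e h B₂ lam
  rw [hN0, jet12_zero_left, smul_zero, zero_add] at R12 R1 R2
  simp only [smul_eq_mul] at R12 R1 R2
  -- the chart's letter fields at bond letters
  have hG1 : gaugeDir₁ e B₁ lam = bondLetter u κ K₁ := gaugeDir₁_bondLetter_smul e u κ Y₁ X ell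
  have hG2 : gaugeDir₁ e B₂ lam = bondLetter u' κ' K₂ := gaugeDir₁_bondLetter_smul e u' κ' Y₂ X ell
  have hG12 : gaugeDir₁ e (B₁ + B₂) lam = bondLetter u κ K₁ + bondLetter u' κ' K₂ := by rw [gaugeDir₁_add, hG1, hG2]
  -- (2,2): coordinates in the family `T`
  have hV : field T (Pi.single (x, ((0 : Fin 3), α)) (1 : ℝ)) = h := field_single T x 0 α
  have hg : field T (fun Q : Λ × (Fin 3 × D) => if Q.2.1 = 0 then ell Q.1 - ell (Q.1 + e Q.2.2) else 0) = gaugeDir₀ e lam :=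
    field_gaugeVec T e ell 0
  have hu : field T (Pi.single (u, ((1 : Fin 3), κ)) (1 : ℝ)) = B₁ := field_single T u 1 κ
  have hu' : field T (Pi.single (u', ((2 : Fin 3), κ')) (1 : ℝ)) = B₂ := field_single T u' 2 κ'
  have e22 := jet22_polar₂_field τ hτ T e (Pi.single (x, ((0 : Fin 3), α)) (1 : ℝ))
    (fun Q : Λ × (Fin 3 × D) => if Q.2.1 = 0 then ell Q.1 - ell (Q.1 + e Q.2.2) else 0)
    (Pi.single (u, ((1 : Fin 3), κ)) (1 : ℝ)) (Pi.single (u', ((2 : Fin 3), κ')) (1 : ℝ))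
  rw [field_add, field_add, hV, hg, hu, hu', sum_single_mul_single_smul, single_dotProduct, one_mul, mulVec_gaugeVec_apply] at e22
  have e22' : (jet22 ℝ τ e (h + gaugeDir₀ e lam) (B₁ + B₂) - jet22 ℝ τ e h (B₁ + B₂) - jet22 ℝ τ e (gaugeDir₀ e lam) (B₁ + B₂))
      - (jet22 ℝ τ e (h + gaugeDir₀ e lam) B₁ - jet22 ℝ τ e h B₁ - jet22 ℝ τ e (gaugeDir₀ e lam) B₁)
      - (jet22 ℝ τ e (h + gaugeDir₀ e lam) B₂ - jet22 ℝ τ e h B₂ - jet22 ℝ τ e (gaugeDir₀ e lam) B₂) =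
      ∑ z : Λ, ∑ γ : D,
        ((wilsonVertex₂ τ T e (u, ((1 : Fin 3), κ)) (u', ((2 : Fin 3), κ')) + wilsonVertex₂ τ T e (u', ((2 : Fin 3), κ')) (u, ((1 : Fin 3), κ)))
            (x, ((0 : Fin 3), α)) (z, ((0 : Fin 3), γ))
          + (wilsonVertex₂ τ T e (u, ((1 : Fin 3), κ)) (u', ((2 : Fin 3), κ')) + wilsonVertex₂ τ T e (u', ((2 : Fin 3), κ')) (u, ((1 : Fin 3), κ)))
            (z, ((0 : Fin 3), γ)) (x, ((0 : Fin 3), α)))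
          * (ell z - ell (z + e γ)) := by
    rw [e22]
    refine Finset.sum_congr rfl fun z _ => Finset.sum_congr rfl fun γ _ => ?_
    simp only [Matrix.add_apply, Matrix.transpose_apply]
  -- (2,1): split background and direction, evaluate the four polar forms
  have p11 := jet21_polar_bondLetters τ hτ e (x, α) (u, κ) (u, κ) X K₁ Y₁
  have p12 := jet21_polar_bondLetters τ hτ e (x, α) (u, κ) (u', κ') X K₁ Y₂
  have p21 := jet21_polar_bondLetters τ hτ e (x, α) (u', κ') (u, κ) X K₂ Y₁
  have p22 := jet21_polar_bondLetters τ hτ e (x, α) (u', κ') (u', κ') X K₂ Y₂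
  have e21 : (jet21 ℝ τ e (h + gaugeDir₁ e (B₁ + B₂) lam) (B₁ + B₂) - jet21 ℝ τ e h (B₁ + B₂)
        - jet21 ℝ τ e (gaugeDir₁ e (B₁ + B₂) lam) (B₁ + B₂))
      - (jet21 ℝ τ e (h + gaugeDir₁ e B₁ lam) B₁ - jet21 ℝ τ e h B₁ - jet21 ℝ τ e (gaugeDir₁ e B₁ lam) B₁)
      - (jet21 ℝ τ e (h + gaugeDir₁ e B₂ lam) B₂ - jet21 ℝ τ e h B₂ - jet21 ℝ τ e (gaugeDir₁ e B₂ lam) B₂) =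
      -(2 * τ (Y₂ * (X * K₁ - K₁ * X)) * S₀A e u' κ' (x, α) (u, κ)) + -(2 * τ (Y₁ * (X * K₂ - K₂ * X)) * S₀A e u κ (x, α) (u', κ')) := by
    rw [hG12, hG1, hG2]
    simp only [jet21_add_bg ℝ τ hτ]
    have s1 := jet21_polarW_add_right τ e h (bondLetter u κ K₁) (bondLetter u' κ' K₂) B₁
    have s2 := jet21_polarW_add_right τ e h (bondLetter u κ K₁) (bondLetter u' κ' K₂) B₂
    simp only [hh, hB₁, hB₂] at s1 s2 ⊢
    dsimp only at p11 p12 p21 p22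
    linear_combination s1 + s2 + p12 + p21
  -- (2,0): the kinetic pairing with the cross of the doubled second direction
  have e20 : (jet20 ℝ τ e (h + fun y k => (B₁ + B₂) y k * gaugeDir₁ e (B₁ + B₂) lam y k - gaugeDir₁ e (B₁ + B₂) lam y k * (B₁ + B₂) y k) (B₁ + B₂)
        - jet20 ℝ τ e h (B₁ + B₂)
        - jet20 ℝ τ e (fun y k => (B₁ + B₂) y k * gaugeDir₁ e (B₁ + B₂) lam y k - gaugeDir₁ e (B₁ + B₂) lam y k * (B₁ + B₂) y k) (B₁ + B₂))
      - (jet20 ℝ τ e (h + fun y k => B₁ y k * gaugeDir₁ e B₁ lam y k - gaugeDir₁ e B₁ lam y k * B₁ y k) B₁ - jet20 ℝ τ e h B₁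
        - jet20 ℝ τ e (fun y k => B₁ y k * gaugeDir₁ e B₁ lam y k - gaugeDir₁ e B₁ lam y k * B₁ y k) B₁)
      - (jet20 ℝ τ e (h + fun y k => B₂ y k * gaugeDir₁ e B₂ lam y k - gaugeDir₁ e B₂ lam y k * B₂ y k) B₂ - jet20 ℝ τ e h B₂
        - jet20 ℝ τ e (fun y k => B₂ y k * gaugeDir₁ e B₂ lam y k - gaugeDir₁ e B₂ lam y k * B₂ y k) B₂) =
      (2 * Lc e κ u (x, α)) * τ (X * (if u = u' ∧ κ = κ' then Y₁ * K₂ - K₂ * Y₁ + (Y₂ * K₁ - K₁ * Y₂) else 0)) := by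
    rw [jet20_polar τ hτ, jet20_polar τ hτ, jet20_polar τ hτ, ← kin_sub_right, ← kin_sub_right, hB₁, hB₂, hlam, gaugeDir₂_cross, hh]
    exact kin_bondLetter τ e (x, α) (u, κ) X _
  -- (1,1): the current, bilinear, at the bond letters
  have hN1 : (fun y k => gaugeDir₁ e B₁ lam y k * h y k - h y k * gaugeDir₁ e B₁ lam y k) =
      bondLetter x α (if x = u ∧ α = κ then K₁ * X - X * K₁ else 0) := by
    rw [hB₁, hlam, hh]; exact currArg₁_bondLetters e u κ Y₁ X ell x α
  have hN2 : (fun y k => gaugeDir₁ e B₂ lam y k * h y k - h y k * gaugeDir₁ e B₂ lam y k) =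
      bondLetter x α (if x = u' ∧ α = κ' then K₂ * X - X * K₂ else 0) := by
    rw [hB₂, hlam, hh]; exact currArg₁_bondLetters e u' κ' Y₂ X ell x α
  have j11 : ∀ (A Z : 𝔸) (q : Λ × D), jet11 ℝ τ e (bondLetter x α A) (bondLetter q.1 q.2 Z) = (2 * Lc e q.2 q.1 (x, α)) * τ (A * Z) := by
    intro A Z q
    rw [jet11_eq_kin ℝ τ hτ]
    exact kin_bondLetter τ e (x, α) q A Z
  have e11 : jet11 ℝ τ e (fun y k => gaugeDir₁ e (B₁ + B₂) lam y k * h y k - h y k * gaugeDir₁ e (B₁ + B₂) lam y k) (B₁ + B₂)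
      - jet11 ℝ τ e (fun y k => gaugeDir₁ e B₁ lam y k * h y k - h y k * gaugeDir₁ e B₁ lam y k) B₁
      - jet11 ℝ τ e (fun y k => gaugeDir₁ e B₂ lam y k * h y k - h y k * gaugeDir₁ e B₂ lam y k) B₂ =
      (2 * Lc e κ' u' (x, α)) * τ ((if x = u ∧ α = κ then K₁ * X - X * K₁ else 0) * Y₂)
        + (2 * Lc e κ u (x, α)) * τ ((if x = u' ∧ α = κ' then K₂ * X - X * K₂ else 0) * Y₁) := by
    rw [currArg₁_add, hN1, hN2, jet11_add_left ℝ τ hτ, jet11_add_right ℝ τ hτ, jet11_add_right ℝ τ hτ, hB₁, hB₂,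
      j11 _ _ (u, κ), j11 _ _ (u', κ'), j11 _ _ (u, κ), j11 _ _ (u', κ')]
    ring
  -- assemble
  linear_combination R12 - R1 - R2 - 4 * e22' - 4 * e21 - 2 * e20 + 2 * e11

end Main

end Summit.QuantumFields.BalabanUV.Beta.WilsonFluctuationWard22Entry
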